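import Summits.Ventures.Crystal3D.Theorems.StickyWulffConstantCoaxialWallLawLedgerWithDefs
import HarnessLib

/-!
# Explicit-constant currency, brick 1b: the deficiency-form matrix `GenericWallFloorWithCharge C R₀ c` and the frame step

HONEST FRAMING. Venture `Summits/Ventures/Crystal3D` (cell `crystal3d-full`); helper for the crux `TextureLiminf`
(stmt-Ventures-19483, line `TexShadow`) and lane F's debt F-U.  DEFINITIONS + BOOKKEEPING ONLY (census-free, standard axioms);
F-C1 not moved.  Continues `…CoaxialWallLawLedgerWithDefs` (cf-p1 (lxvii): restatement programme at the literal `R₀ = 10`):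
the deficiency-form per-pair matrix `GenericWallFloorAtCharge c A₁ t₁ A₂ t₂ := ∃ C R₀, …` (`…GenericWallFloorAtHalf`) is ALSO a
per-pair existential, so the leaves that reach the adhesion form through it (`…GenericWallFloorAtDirs`, the in-plane stack
walkers) need its explicit-constant twin.

* `GenericWallFloorWithCharge C R₀ c A₁ t₁ A₂ t₂` — the matrix of `GenericWallFloorAtCharge c` AT `(C, R₀)`;
  `genericWallFloorAtCharge_of_with`, `genericWallFloorWithCharge_mono` (charge), `…_weaken` (constant);
* `twoSlabLedgerWith_of_withCharge` — the uniform converter (`twoSlabLedgerWith_of_atCharge_unif`) read on the new currency: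
  one absolute `K ≥ 0` with `GenericWallFloorWithCharge C R₀ c ⇒ TwoSlabLedgerWith (|C| + K (1 + R₀)) R₀ c` (`R₀ ≥ 1`);
* `coaxialOnWith_of_twoSlabLedgerWith_frame` — `coaxialStub_of_twoSlabLedgerAt_frame` in the With-currency: a cell at `(C, R₀, q)`
  and a presenting frame `L` with lane F's charge `≤ q` give the `CoaxialTwoSlabAdhesionOnWith C R₀`-conclusion for the pair.
-/

noncomputable section

namespace Summit.Ventures.Crystal3D.Theorems

open Summit.Ventures.Crystal3D Finset
open Literature.MathematicalPhysics.StatisticalMechanics (fccStacking barlowStacking IsHaggSeq contactDeficiency)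
open scoped InnerProductSpace

/-- **`GenericWallFloorAtCharge c` AT the constants `(C, R₀)`**: the deficiency-form clamped-cylinder cell
`(φ₁ + φ₂ + c) π ρ² − C (1 + h) ρ ≤ 6N − #contacts` for every unit packing filling the cell with both slab samples complete. -/
def GenericWallFloorWithCharge (C R₀ c : ℝ) (A₁ : EuclideanSpace ℝ (Fin 3) ≃ₗᵢ[ℝ] EuclideanSpace ℝ (Fin 3))
    (t₁ : EuclideanSpace ℝ (Fin 3)) (A₂ : EuclideanSpace ℝ (Fin 3) ≃ₗᵢ[ℝ] EuclideanSpace ℝ (Fin 3))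
    (t₂ : EuclideanSpace ℝ (Fin 3)) : Prop :=
  ∀ h : ℝ, 0 ≤ h → ∀ ρ : ℝ, R₀ ≤ ρ → ∀ (N : ℕ) (x : Fin N → EuclideanSpace ℝ (Fin 3)),
    Summit.Ventures.Crystal3D.IsUnitPacking x → (∀ i, -(2 * R₀) ≤ x i 2 ∧ x i 2 ≤ h + 2 * R₀ ∧ x i 0 ^ 2 + x i 1 ^ 2 ≤ ρ ^ 2) →
    (∀ p ∈ (fun p => A₁ p + t₁) '' fccStacking 1 (Real.sqrt (2 / 3)),
      (-(2 * R₀) ≤ p 2 ∧ p 2 ≤ -R₀ ∧ p 0 ^ 2 + p 1 ^ 2 ≤ ρ ^ 2) → ∃ i, x i = p) →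
    (∀ p ∈ (fun p => A₂ p + t₂) '' fccStacking 1 (Real.sqrt (2 / 3)),
      (h + R₀ ≤ p 2 ∧ p 2 ≤ h + 2 * R₀ ∧ p 0 ^ 2 + p 1 ^ 2 ≤ ρ ^ 2) → ∃ i, x i = p) →
    (Real.sqrt 2 / 4 * ∑ᶠ w ∈ {w ∈ fccStacking 1 (Real.sqrt (2 / 3)) | ‖w‖ = 1},
        |⟪w, A₁.symm (EuclideanSpace.single (2 : Fin 3) (1 : ℝ))⟫_ℝ| +
      Real.sqrt 2 / 4 * ∑ᶠ w ∈ {w ∈ fccStacking 1 (Real.sqrt (2 / 3)) | ‖w‖ = 1},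
        |⟪w, A₂.symm (EuclideanSpace.single (2 : Fin 3) (1 : ℝ))⟫_ℝ| + c) * Real.pi * ρ ^ 2 - C * (1 + h) * ρ ≤
      6 * (N : ℝ) - (Summit.Ventures.Crystal3D.numContacts x : ℝ)

/-- The explicit-constant deficiency matrix with `R₀ > 0` gives the existential `GenericWallFloorAtCharge c`. -/
theorem genericWallFloorAtCharge_of_with {C R₀ c : ℝ} {A₁ : EuclideanSpace ℝ (Fin 3) ≃ₗᵢ[ℝ] EuclideanSpace ℝ (Fin 3)} {t₁ : EuclideanSpace ℝ (Fin 3)}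
    {A₂ : EuclideanSpace ℝ (Fin 3) ≃ₗᵢ[ℝ] EuclideanSpace ℝ (Fin 3)} {t₂ : EuclideanSpace ℝ (Fin 3)} (hR₀ : 0 < R₀)
    (h : GenericWallFloorWithCharge C R₀ c A₁ t₁ A₂ t₂) : GenericWallFloorAtCharge c A₁ t₁ A₂ t₂ :=
  ⟨C, R₀, hR₀, h⟩

/-- Lowering the charge only weakens the deficiency matrix. -/
theorem genericWallFloorWithCharge_mono {C R₀ c c' : ℝ} {A₁ : EuclideanSpace ℝ (Fin 3) ≃ₗᵢ[ℝ] EuclideanSpace ℝ (Fin 3)} {t₁ : EuclideanSpace ℝ (Fin 3)}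
    {A₂ : EuclideanSpace ℝ (Fin 3) ≃ₗᵢ[ℝ] EuclideanSpace ℝ (Fin 3)} {t₂ : EuclideanSpace ℝ (Fin 3)} (hcc : c ≤ c')
    (h : GenericWallFloorWithCharge C R₀ c' A₁ t₁ A₂ t₂) : GenericWallFloorWithCharge C R₀ c A₁ t₁ A₂ t₂ := by
  intro hh hh0 ρ hρ N x hx hcell h₁ h₂
  have hle := h hh hh0 ρ hρ N x hx hcell h₁ h₂
  have : 0 ≤ (c' - c) * Real.pi * ρ ^ 2 :=
    mul_nonneg (mul_nonneg (sub_nonneg.2 hcc) Real.pi_pos.le) (sq_nonneg ρ)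
  linarith

/-- Enlarging the constant `C` (with `R₀ ≥ 0`) only weakens the deficiency matrix. -/
theorem genericWallFloorWithCharge_weaken {C C' R₀ c : ℝ} {A₁ : EuclideanSpace ℝ (Fin 3) ≃ₗᵢ[ℝ] EuclideanSpace ℝ (Fin 3)} {t₁ : EuclideanSpace ℝ (Fin 3)}
    {A₂ : EuclideanSpace ℝ (Fin 3) ≃ₗᵢ[ℝ] EuclideanSpace ℝ (Fin 3)} {t₂ : EuclideanSpace ℝ (Fin 3)} (hR₀ : 0 ≤ R₀) (hCC : C ≤ C')
    (h : GenericWallFloorWithCharge C R₀ c A₁ t₁ A₂ t₂) : GenericWallFloorWithCharge C' R₀ c A₁ t₁ A₂ t₂ := by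
  intro hh hh0 ρ hρ N x hx hcell h₁ h₂
  have hle := h hh hh0 ρ hρ N x hx hcell h₁ h₂
  have hρ0 : 0 ≤ ρ := hR₀.trans hρ
  have : C * (1 + hh) * ρ ≤ C' * (1 + hh) * ρ :=
    mul_le_mul_of_nonneg_right (mul_le_mul_of_nonneg_right hCC (by linarith)) hρ0
  linarith

/-- **The uniform deficiency ⇒ adhesion converter on the With-currency**: one absolute `K ≥ 0` such that
`GenericWallFloorWithCharge C R₀ c ⇒ TwoSlabLedgerWith (|C| + K (1 + R₀)) R₀ c` for every pair and every `R₀ ≥ 1`. -/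
theorem twoSlabLedgerWith_of_withCharge : ∃ K : ℝ, 0 ≤ K ∧ ∀ {C R₀ c : ℝ}
    {A₁ : EuclideanSpace ℝ (Fin 3) ≃ₗᵢ[ℝ] EuclideanSpace ℝ (Fin 3)} {t₁ : EuclideanSpace ℝ (Fin 3)}
    {A₂ : EuclideanSpace ℝ (Fin 3) ≃ₗᵢ[ℝ] EuclideanSpace ℝ (Fin 3)} {t₂ : EuclideanSpace ℝ (Fin 3)}, 1 ≤ R₀ →
    GenericWallFloorWithCharge C R₀ c A₁ t₁ A₂ t₂ → TwoSlabLedgerWith (|C| + K * (1 + R₀)) R₀ c A₁ t₁ A₂ t₂ := by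
  obtain ⟨K, hK0, hK⟩ := twoSlabLedgerWith_of_atCharge_unif
  refine ⟨K, hK0, ?_⟩
  intro C R₀ c A₁ t₁ A₂ t₂ hR₀ h
  exact hK A₁ t₁ A₂ t₂ hR₀ h

/-- **The frame step in the With-currency** (`coaxialStub_of_twoSlabLedgerAt_frame` at explicit constants): a cell
`TwoSlabLedgerWith C R₀ q` and a frame `L` presenting both grains with lane F's charge `½ √(1 − ⟪L e₃, e₃⟫²) ≤ q` give the
conclusion of `CoaxialTwoSlabAdhesionOnWith C R₀` for the pair, with THIS frame. -/
theorem coaxialOnWith_of_twoSlabLedgerWith_frame {C R₀ q : ℝ}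
    {A₁ : EuclideanSpace ℝ (Fin 3) ≃ₗᵢ[ℝ] EuclideanSpace ℝ (Fin 3)} {t₁ : EuclideanSpace ℝ (Fin 3)}
    {A₂ : EuclideanSpace ℝ (Fin 3) ≃ₗᵢ[ℝ] EuclideanSpace ℝ (Fin 3)} {t₂ : EuclideanSpace ℝ (Fin 3)}
    (hcell : TwoSlabLedgerWith C R₀ q A₁ t₁ A₂ t₂)
    (L : EuclideanSpace ℝ (Fin 3) ≃ₗᵢ[ℝ] EuclideanSpace ℝ (Fin 3)) (s₁ s₂ : EuclideanSpace ℝ (Fin 3)) {σ σ' : ℤ → ℤ}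
    (hσ : IsHaggSeq σ) (hσ' : IsHaggSeq σ')
    (hsub₁ : (fun p => A₁ p + t₁) '' fccStacking 1 (Real.sqrt (2 / 3)) ⊆
      (fun p => L p + s₁) '' barlowStacking 1 (Real.sqrt (2 / 3)) σ)
    (hsub₂ : (fun p => A₂ p + t₂) '' fccStacking 1 (Real.sqrt (2 / 3)) ⊆
      (fun p => L p + s₂) '' barlowStacking 1 (Real.sqrt (2 / 3)) σ')
    (hq : (1 / 2 : ℝ) * Real.sqrt (1 - ⟪L (EuclideanSpace.single (2 : Fin 3) (1 : ℝ)),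
      (EuclideanSpace.single (2 : Fin 3) (1 : ℝ))⟫_ℝ ^ 2) ≤ q) :
    ∃ (L : EuclideanSpace ℝ (Fin 3) ≃ₗᵢ[ℝ] EuclideanSpace ℝ (Fin 3))
        (s₁ s₂ : EuclideanSpace ℝ (Fin 3)) (σ σ' : ℤ → ℤ), IsHaggSeq σ ∧ IsHaggSeq σ' ∧
        (fun p => A₁ p + t₁) '' fccStacking 1 (Real.sqrt (2 / 3)) ⊆
          (fun p => L p + s₁) '' barlowStacking 1 (Real.sqrt (2 / 3)) σ ∧
        (fun p => A₂ p + t₂) '' fccStacking 1 (Real.sqrt (2 / 3)) ⊆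
          (fun p => L p + s₂) '' barlowStacking 1 (Real.sqrt (2 / 3)) σ' ∧
        TwoSlabLedgerWith C R₀ ((1 / 2 : ℝ) * Real.sqrt (1 - ⟪L (EuclideanSpace.single (2 : Fin 3) (1 : ℝ)),
          (EuclideanSpace.single (2 : Fin 3) (1 : ℝ))⟫_ℝ ^ 2)) A₁ t₁ A₂ t₂ :=
  ⟨L, s₁, s₂, σ, σ', hσ, hσ', hsub₁, hsub₂, twoSlabLedgerWith_anti hq hcell⟩

end Summit.Ventures.Crystal3D.Theorems

end
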